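import Summits.AtomisticToContinuum.Crystallization.Theorems.OverbindingBudgetAffineTaylorCellSoundness

/-!
# OverbindingBudget — Taylor-model cells for the far-window certificate, part 5/16 «Product»

MODULE PLAN (lens-4 g68, at hand-2's landing-shape request of 2026-09-02T14:19Z, critic row 1199 (II)) of the VERIFIED g67 leaf
`OverbindingBudgetAffineTaylorCell.lean` (sha256 `dabedef39e0c5fd2…`, 4214 l, critic row 1196): this module = leaf l.1073–1347
(§5 slot product truncated at degree 4 and its soundness), body VERBATIM except as listed in `MAP.md` — here: l.1144 unbounded-heartbeats override replaced by the explicit bound 800000 (pairTableOK_true).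
Same namespace `…Theorems.OverbindingBudgetAffineTaylorCell` in all 16 parts (declaration names unchanged); the parts import each other
linearly.  No `sorry`, no `native_decide`, standard axioms; no instances/notation; scoped `set_option maxHeartbeats` with explicit bounds only.
-/

namespace Summit.AtomisticToContinuum.Crystallization.Theorems.OverbindingBudgetAffineTaylorCell

/-! ## §5 Slot PRODUCT truncated at degree 4 (for `W²` in `Q = A·V − B·W²`) and its soundness on the box

`slotProdCoef a b mo` = `Σ_{α+β = key(mo)} a_α b_β` over pairs of slots (degree pre-test first); pairs of total degree `≥ 5`
have no slot and go to the DROPPED bound `slotProdDrop` (`Σ |a_α||b_β| h^α h^β`).  Soundness (`slotProd_sound`):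
`|evalCoef a t · evalCoef b t − evalCoef (slotProd a b) t| ≤ slotProdDrop` on the box.  The only table fact needed —
«for slots `α, β` of total degree `≤ 4` exactly one slot carries the key `α+β`, else none» — is `monos_pair_table`,
checked by `decide +kernel`. -/

/-- `Mono.key` (docstring added by the landing lane; see the module docstring). [formal bookkeeping] -/
def Mono.key (mo : Mono) : ℕ × ℕ × ℕ × ℕ × ℕ := (mo.e1, mo.e2, mo.e3, mo.e4, mo.e5)
/-- `Mono.addKey` (docstring added by the landing lane; see the module docstring). [formal bookkeeping] -/
def Mono.addKey (a b : Mono) : ℕ × ℕ × ℕ × ℕ × ℕ := (a.e1 + b.e1, a.e2 + b.e2, a.e3 + b.e3, a.e4 + b.e4, a.e5 + b.e5)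

/-- `evKey` (docstring added by the landing lane; see the module docstring). [formal bookkeeping] -/
def evKey (k : ℕ × ℕ × ℕ × ℕ × ℕ) (t1 t2 t3 t4 t5 : ℝ) : ℝ :=
  t1 ^ k.1 * t2 ^ k.2.1 * t3 ^ k.2.2.1 * t4 ^ k.2.2.2.1 * t5 ^ k.2.2.2.2

/-- `Mono.ev_eq_evKey` (docstring added by the landing lane; see the module docstring). [formal bookkeeping] -/
theorem Mono.ev_eq_evKey (mo : Mono) (t1 t2 t3 t4 t5 : ℝ) : mo.ev t1 t2 t3 t4 t5 = evKey mo.key t1 t2 t3 t4 t5 := rfl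

/-- `evKey_addKey` (docstring added by the landing lane; see the module docstring). [formal bookkeeping] -/
theorem evKey_addKey (a b : Mono) (t1 t2 t3 t4 t5 : ℝ) :
    evKey (a.addKey b) t1 t2 t3 t4 t5 = a.ev t1 t2 t3 t4 t5 * b.ev t1 t2 t3 t4 t5 := by
  simp only [evKey, Mono.addKey, Mono.ev, pow_add]; ring

/-- Box weight `h^α` of a slot. -/
def Mono.hv (mo : Mono) (C : Cell) : ℚ := C.h1 ^ mo.e1 * C.h2 ^ mo.e2 * C.h3 ^ mo.e3 * C.h4 ^ mo.e4 * C.h5 ^ mo.e5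

/-- `Mono.ev_abs_le_hv` (docstring added by the landing lane; see the module docstring). [formal bookkeeping] -/
theorem Mono.ev_abs_le_hv (mo : Mono) (C : Cell) (t1 t2 t3 t4 t5 : ℝ)
    (h1 : |t1| ≤ C.h1) (h2 : |t2| ≤ C.h2) (h3 : |t3| ≤ C.h3) (h4 : |t4| ≤ C.h4) (h5 : |t5| ≤ C.h5) :
    |mo.ev t1 t2 t3 t4 t5| ≤ (mo.hv C : ℝ) := by
  unfold Mono.ev Mono.hv
  push_cast
  rw [abs_mul, abs_mul, abs_mul, abs_mul, abs_pow, abs_pow, abs_pow, abs_pow, abs_pow]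
  have p1 : |t1| ^ mo.e1 ≤ (C.h1 : ℝ) ^ mo.e1 := pow_le_pow_left₀ (abs_nonneg _) h1 _
  have p2 : |t2| ^ mo.e2 ≤ (C.h2 : ℝ) ^ mo.e2 := pow_le_pow_left₀ (abs_nonneg _) h2 _
  have p3 : |t3| ^ mo.e3 ≤ (C.h3 : ℝ) ^ mo.e3 := pow_le_pow_left₀ (abs_nonneg _) h3 _
  have p4 : |t4| ^ mo.e4 ≤ (C.h4 : ℝ) ^ mo.e4 := pow_le_pow_left₀ (abs_nonneg _) h4 _
  have p5 : |t5| ^ mo.e5 ≤ (C.h5 : ℝ) ^ mo.e5 := pow_le_pow_left₀ (abs_nonneg _) h5 _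
  have g1 : (0 : ℝ) ≤ C.h1 := (abs_nonneg _).trans h1
  have g2 : (0 : ℝ) ≤ C.h2 := (abs_nonneg _).trans h2
  have g3 : (0 : ℝ) ≤ C.h3 := (abs_nonneg _).trans h3
  have g4 : (0 : ℝ) ≤ C.h4 := (abs_nonneg _).trans h4
  have n1 := pow_nonneg g1 mo.e1
  have n2 := pow_nonneg g2 mo.e2
  have n3 := pow_nonneg g3 mo.e3
  have n4 := pow_nonneg g4 mo.e4
  have q12 := mul_le_mul p1 p2 (pow_nonneg (abs_nonneg _) _) n1
  have q123 := mul_le_mul q12 p3 (pow_nonneg (abs_nonneg _) _) (mul_nonneg n1 n2)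
  have q1234 := mul_le_mul q123 p4 (pow_nonneg (abs_nonneg _) _) (mul_nonneg (mul_nonneg n1 n2) n3)
  exact mul_le_mul q1234 p5 (pow_nonneg (abs_nonneg _) _) (mul_nonneg (mul_nonneg (mul_nonneg n1 n2) n3) n4)

/-- The pair term of the truncated product (degree pre-test, then key match). -/
def pairTerm (p q : ℚ × Mono) (mo : Mono) : ℚ :=
  if p.2.d + q.2.d = mo.d then (if p.2.addKey q.2 = mo.key then p.1 * q.1 else 0) else 0

/-- Coefficient of the result slot `mo` in the truncated product. -/
def slotProdCoef (a b : List ℚ) (mo : Mono) : ℚ :=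
  ((a.zip monos).map fun p => ((b.zip monos).map fun q => pairTerm p q mo).sum).sum

/-- The truncated (degree `≤ 4`) product of two slot polynomials. -/
def slotProd (a b : List ℚ) : List ℚ := monos.map (slotProdCoef a b)

/-- Bound for the dropped pairs (total degree `≥ 5`) on the box. -/
def slotProdDrop (C : Cell) (a b : List ℚ) : ℚ :=
  ((a.zip monos).map fun p => ((b.zip monos).map fun q =>
    if 4 < p.2.d + q.2.d then |p.1| * |q.1| * (p.2.hv C * q.2.hv C) else 0).sum).sum

/-- The indicator count of the table fact, as a `ℕ` computation. -/
def pairIndSumN (ma mb : Mono) : ℕ :=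
  (monos.map fun mo => if ma.d + mb.d = mo.d then (if ma.addKey mb = mo.key then 1 else 0) else 0).sum

/-- Only pairs of total degree `≤ 4` are scanned (≈ 10³ pairs × 126 slots): kernel-cheap. -/
def pairTableOK : Bool :=
  monos.all fun ma => monos.all fun mb => if ma.d + mb.d ≤ 4 then pairIndSumN ma mb == 1 else true

set_option maxHeartbeats 800000 in
/-- `pairTableOK_true` (docstring added by the landing lane; see the module docstring). [formal bookkeeping] -/
theorem pairTableOK_true : pairTableOK = true := by decide +kernel

/-- `monos_d_le_four` (docstring added by the landing lane; see the module docstring). [formal bookkeeping] -/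
theorem monos_d_le_four : ∀ mo ∈ monos, mo.d ≤ 4 := by decide +kernel

/-- THE TABLE FACT (kernel-decided): for slots `α, β ∈ monos`, exactly one result slot carries the key `α+β` if
`deg α + deg β ≤ 4`, none otherwise. -/
theorem monos_pair_table : ∀ ma ∈ monos, ∀ mb ∈ monos,
    pairIndSumN ma mb = if ma.d + mb.d ≤ 4 then 1 else 0 := by
  intro ma hma mb hmb
  split_ifs with hd
  · have h := pairTableOK_true
    unfold pairTableOK at h
    rw [List.all_eq_true] at h
    have h2 := h ma hma
    rw [List.all_eq_true] at h2
    have h3 := h2 mb hmb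
    rw [if_pos hd] at h3
    exact beq_iff_eq.mp h3
  · unfold pairIndSumN
    have hz : (monos.map fun mo => if ma.d + mb.d = mo.d then (if ma.addKey mb = mo.key then 1 else 0) else 0)
        = monos.map fun _ => (0 : ℕ) := by
      apply List.map_congr_left; intro mo hmo
      have := monos_d_le_four mo hmo
      rw [if_neg (by omega)]
    rw [hz]
    simp

/-- Generic swap of two finite list sums. -/
theorem list_sum_comm {ι κ : Type*} (l : List ι) (s : List κ) (F : ι → κ → ℝ) :
    (l.map fun i => (s.map fun k => F i k).sum).sum = (s.map fun k => (l.map fun i => F i k).sum).sum := by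
  induction l with
  | nil => simp
  | cons i l ih =>
    rw [List.map_cons, List.sum_cons, ih]
    have : (s.map fun k => ((i :: l).map fun i => F i k).sum) = s.map fun k => F i k + (l.map fun i => F i k).sum := by
      apply List.map_congr_left; intro k _; rw [List.map_cons, List.sum_cons]
    rw [this, List.sum_map_add]

/-- `mul_list_sum` (docstring added by the landing lane; see the module docstring). [formal bookkeeping] -/
theorem mul_list_sum {κ : Type*} (s : List κ) (r : ℝ) (g : κ → ℝ) :
    r * (s.map g).sum = (s.map fun k => r * g k).sum := by
  induction s with
  | nil => simp
  | cons k s ih => simp [mul_add, ih]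

/-- `list_sum_mul` (docstring added by the landing lane; see the module docstring). [formal bookkeeping] -/
theorem list_sum_mul {ι : Type*} (l : List ι) (f : ι → ℝ) (r : ℝ) :
    (l.map f).sum * r = (l.map fun i => f i * r).sum := by
  induction l with
  | nil => simp
  | cons i l ih => simp [add_mul, ih]

/-- `list_sum_mul_list_sum` (docstring added by the landing lane; see the module docstring). [formal bookkeeping] -/
theorem list_sum_mul_list_sum {ι κ : Type*} (l : List ι) (s : List κ) (f : ι → ℝ) (g : κ → ℝ) :
    (l.map f).sum * (s.map g).sum = (l.map fun i => (s.map fun k => f i * g k).sum).sum := by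
  rw [list_sum_mul]
  congr 1; apply List.map_congr_left; intro i _
  rw [mul_list_sum]

/-- `list_sum_map_sub` (docstring added by the landing lane; see the module docstring). [formal bookkeeping] -/
theorem list_sum_map_sub {ι : Type*} (l : List ι) (f g : ι → ℝ) :
    (l.map f).sum - (l.map g).sum = (l.map fun i => f i - g i).sum := by
  induction l with
  | nil => simp
  | cons i l ih => simp only [List.map_cons, List.sum_cons, ← ih]; ring

/-- `list_abs_sum_le` (docstring added by the landing lane; see the module docstring). [formal bookkeeping] -/
theorem list_abs_sum_le {ι : Type*} (l : List ι) (f : ι → ℝ) : |(l.map f).sum| ≤ (l.map fun i => |f i|).sum := by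
  induction l with
  | nil => simp
  | cons i l ih =>
    rw [List.map_cons, List.sum_cons, List.map_cons, List.sum_cons]
    exact (abs_add_le _ _).trans (add_le_add le_rfl ih)

/-- `list_sum_le_sum` (docstring added by the landing lane; see the module docstring). [formal bookkeeping] -/
theorem list_sum_le_sum {ι : Type*} (l : List ι) (f g : ι → ℝ) (h : ∀ i ∈ l, f i ≤ g i) :
    (l.map f).sum ≤ (l.map g).sum := by
  induction l with
  | nil => simp
  | cons i l ih =>
    rw [List.map_cons, List.sum_cons, List.map_cons, List.sum_cons]
    exact add_le_add (h i (by simp)) (ih fun j hj => h j (by simp [hj]))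

/-- `evalCoef_eq_zip` (docstring added by the landing lane; see the module docstring). [formal bookkeeping] -/
theorem evalCoef_eq_zip (a : List ℚ) (t1 t2 t3 t4 t5 : ℝ) :
    evalCoef a t1 t2 t3 t4 t5 = ((a.zip monos).map fun p => (p.1 : ℝ) * p.2.ev t1 t2 t3 t4 t5).sum := by
  unfold evalCoef
  rw [← List.map_uncurry_zip_eq_zipWith]
  rfl

/-- `evalCoef_monos_map` (docstring added by the landing lane; see the module docstring). [formal bookkeeping] -/
theorem evalCoef_monos_map (g : Mono → ℚ) (t1 t2 t3 t4 t5 : ℝ) :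
    evalCoef (monos.map g) t1 t2 t3 t4 t5 = (monos.map fun mo => (g mo : ℝ) * mo.ev t1 t2 t3 t4 t5).sum := by
  unfold evalCoef
  rw [zipWith_map_self]

/-- The matching sum in real form: for table slots `ma, mb`, summing `mo.ev` over the matching result slots gives
`evKey (ma+mb)` if the total degree is `≤ 4`, else `0`. -/
theorem monos_pair_ev (ma mb : Mono) (hma : ma ∈ monos) (hmb : mb ∈ monos) (t1 t2 t3 t4 t5 : ℝ) :
    (monos.map fun mo => if ma.d + mb.d = mo.d then (if ma.addKey mb = mo.key then mo.ev t1 t2 t3 t4 t5 else 0) else 0).sum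
      = if ma.d + mb.d ≤ 4 then evKey (ma.addKey mb) t1 t2 t3 t4 t5 else 0 := by
  have htab := monos_pair_table ma hma mb hmb
  have hcast : (monos.map fun mo => if ma.d + mb.d = mo.d then (if ma.addKey mb = mo.key then (1 : ℝ) else 0) else 0).sum
      = if ma.d + mb.d ≤ 4 then (1 : ℝ) else 0 := by
    have h0 : ((pairIndSumN ma mb : ℕ) : ℝ) = ((if ma.d + mb.d ≤ 4 then 1 else 0 : ℕ) : ℝ) :=
      congrArg (Nat.cast : ℕ → ℝ) htab
    unfold pairIndSumN at h0
    rw [Nat.cast_list_sum, List.map_map] at h0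
    rw [show (if ma.d + mb.d ≤ 4 then (1 : ℝ) else 0) = ((if ma.d + mb.d ≤ 4 then 1 else 0 : ℕ) : ℝ) by
      split_ifs <;> simp]
    have e : (monos.map fun mo => if ma.d + mb.d = mo.d then (if ma.addKey mb = mo.key then (1 : ℝ) else 0) else 0)
        = monos.map (Nat.cast ∘ fun mo => if ma.d + mb.d = mo.d then (if ma.addKey mb = mo.key then 1 else 0) else 0) := by
      apply List.map_congr_left; intro mo _
      simp only [Function.comp]
      split_ifs <;> simp
    rw [e, h0]
  have hrw : (monos.map fun mo => if ma.d + mb.d = mo.d then (if ma.addKey mb = mo.key then mo.ev t1 t2 t3 t4 t5 else 0) else 0)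
      = monos.map fun mo => (if ma.d + mb.d = mo.d then (if ma.addKey mb = mo.key then (1 : ℝ) else 0) else 0)
          * evKey (ma.addKey mb) t1 t2 t3 t4 t5 := by
    apply List.map_congr_left; intro mo _
    by_cases h1 : ma.d + mb.d = mo.d
    · by_cases h2 : ma.addKey mb = mo.key
      · rw [if_pos h1, if_pos h2, if_pos h1, if_pos h2, one_mul, Mono.ev_eq_evKey, h2]
      · rw [if_pos h1, if_neg h2, if_pos h1, if_neg h2, zero_mul]
    · rw [if_neg h1, if_neg h1, zero_mul]
  rw [hrw, List.sum_map_mul_right, hcast]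
  split_ifs <;> simp

/-- `pairTerm_cast` (docstring added by the landing lane; see the module docstring). [formal bookkeeping] -/
theorem pairTerm_cast (p q : ℚ × Mono) (mo : Mono) :
    ((pairTerm p q mo : ℚ) : ℝ) = if p.2.d + q.2.d = mo.d then (if p.2.addKey q.2 = mo.key then (p.1 : ℝ) * q.1 else 0) else 0 := by
  unfold pairTerm; split_ifs <;> push_cast <;> rfl

/-- PRODUCT SOUNDNESS on the box. -/
theorem slotProd_sound (C : Cell) (a b : List ℚ) (t1 t2 t3 t4 t5 : ℝ)
    (h1 : |t1| ≤ C.h1) (h2 : |t2| ≤ C.h2) (h3 : |t3| ≤ C.h3) (h4 : |t4| ≤ C.h4) (h5 : |t5| ≤ C.h5) :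
    |evalCoef a t1 t2 t3 t4 t5 * evalCoef b t1 t2 t3 t4 t5 - evalCoef (slotProd a b) t1 t2 t3 t4 t5|
      ≤ (slotProdDrop C a b : ℝ) := by
  set PA := a.zip monos with hPA
  set PB := b.zip monos with hPB
  have memA : ∀ p ∈ PA, p.2 ∈ monos := fun p hp => (List.of_mem_zip hp).2
  have memB : ∀ q ∈ PB, q.2 ∈ monos := fun q hq => (List.of_mem_zip hq).2
  -- the product as a double sum over pairs
  have eAB : evalCoef a t1 t2 t3 t4 t5 * evalCoef b t1 t2 t3 t4 t5
      = (PA.map fun p => (PB.map fun q => (p.1 : ℝ) * q.1 * evKey (p.2.addKey q.2) t1 t2 t3 t4 t5).sum).sum := by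
    rw [evalCoef_eq_zip, evalCoef_eq_zip, ← hPA, ← hPB, list_sum_mul_list_sum]
    congr 1; apply List.map_congr_left; intro p _
    congr 1; apply List.map_congr_left; intro q _
    rw [evKey_addKey]; ring
  -- the truncated product as the same double sum with the degree indicator
  have eP : evalCoef (slotProd a b) t1 t2 t3 t4 t5
      = (PA.map fun p => (PB.map fun q => (p.1 : ℝ) * q.1
          * (if p.2.d + q.2.d ≤ 4 then evKey (p.2.addKey q.2) t1 t2 t3 t4 t5 else 0)).sum).sum := by
    unfold slotProd
    rw [evalCoef_monos_map]
    -- push the cast inside and expand the coefficient as a double sum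
    have step1 : (monos.map fun mo => ((slotProdCoef a b mo : ℚ) : ℝ) * mo.ev t1 t2 t3 t4 t5)
        = monos.map fun mo => (PA.map fun p => (PB.map fun q =>
            (if p.2.d + q.2.d = mo.d then (if p.2.addKey q.2 = mo.key then (p.1 : ℝ) * q.1 else 0) else 0)
              * mo.ev t1 t2 t3 t4 t5).sum).sum := by
      apply List.map_congr_left; intro mo _
      unfold slotProdCoef
      rw [Rat.cast_list_sum, List.map_map, list_sum_mul, ← hPA]
      congr 1; apply List.map_congr_left; intro p _
      simp only [Function.comp]
      rw [Rat.cast_list_sum, List.map_map, list_sum_mul, ← hPB]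
      congr 1; apply List.map_congr_left; intro q _
      simp only [Function.comp, pairTerm_cast]
    rw [step1, list_sum_comm]
    congr 1; apply List.map_congr_left; intro p hp
    rw [list_sum_comm]
    congr 1; apply List.map_congr_left; intro q hq
    have key := monos_pair_ev p.2 q.2 (memA p hp) (memB q hq) t1 t2 t3 t4 t5
    have : (monos.map fun mo => (if p.2.d + q.2.d = mo.d then (if p.2.addKey q.2 = mo.key then (p.1 : ℝ) * q.1 else 0) else 0)
              * mo.ev t1 t2 t3 t4 t5)
        = monos.map fun mo => ((p.1 : ℝ) * q.1) * (if p.2.d + q.2.d = mo.d then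
            (if p.2.addKey q.2 = mo.key then mo.ev t1 t2 t3 t4 t5 else 0) else 0) := by
      apply List.map_congr_left; intro mo _
      split_ifs <;> ring
    rw [this, ← mul_list_sum, key]
  -- difference = dropped pairs
  rw [eAB, eP]
  have ediff : (PA.map fun p => (PB.map fun q => (p.1 : ℝ) * q.1 * evKey (p.2.addKey q.2) t1 t2 t3 t4 t5).sum).sum
      - (PA.map fun p => (PB.map fun q => (p.1 : ℝ) * q.1
          * (if p.2.d + q.2.d ≤ 4 then evKey (p.2.addKey q.2) t1 t2 t3 t4 t5 else 0)).sum).sum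
      = (PA.map fun p => (PB.map fun q => if 4 < p.2.d + q.2.d then
          (p.1 : ℝ) * q.1 * evKey (p.2.addKey q.2) t1 t2 t3 t4 t5 else 0).sum).sum := by
    rw [list_sum_map_sub]
    congr 1; apply List.map_congr_left; intro p _
    rw [list_sum_map_sub]
    congr 1; apply List.map_congr_left; intro q _
    by_cases hd : p.2.d + q.2.d ≤ 4
    · rw [if_pos hd, if_neg (not_lt.mpr hd), sub_self]
    · rw [if_neg hd, if_pos (not_le.mp hd), mul_zero, sub_zero]
  rw [ediff]
  unfold slotProdDrop
  rw [← hPA, ← hPB, Rat.cast_list_sum, List.map_map]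
  refine (list_abs_sum_le _ _).trans (list_sum_le_sum _ _ _ fun p _ => ?_)
  simp only [Function.comp]
  rw [Rat.cast_list_sum, List.map_map]
  refine (list_abs_sum_le _ _).trans (list_sum_le_sum _ _ _ fun q _ => ?_)
  simp only [Function.comp]
  split_ifs with hd
  · push_cast
    rw [abs_mul, abs_mul, evKey_addKey, abs_mul]
    have ea := p.2.ev_abs_le_hv C t1 t2 t3 t4 t5 h1 h2 h3 h4 h5
    have eb := q.2.ev_abs_le_hv C t1 t2 t3 t4 t5 h1 h2 h3 h4 h5
    have hab : |p.2.ev t1 t2 t3 t4 t5| * |q.2.ev t1 t2 t3 t4 t5| ≤ (p.2.hv C : ℝ) * q.2.hv C :=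
      mul_le_mul ea eb (abs_nonneg _) ((abs_nonneg _).trans ea)
    exact mul_le_mul_of_nonneg_left hab (by positivity)
  · simp

end Summit.AtomisticToContinuum.Crystallization.Theorems.OverbindingBudgetAffineTaylorCell
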